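import Summits.BirchSwinnertonDyer.BirchSwinnertonDyer.Theses.KatoTransfer

/-!
# Line `birth` (BC3 skeleton) for crux `KatoTransfer.ShaCorankZeroAtOnePrime`
# (stmt-BirchSwinnertonDyer-18411, route `route-BirchSwinnertonDyer-KatoTransfer`, crux rank 2)

Registered by the skeleton registrar `planner-skel-stmt-BirchSwinnertonDyer-18411-0` (2026-08-17); it
re-publishes, as the crux's tree workfile, the birth skeleton the route's typing planner
(`planner-type-83b8a0e411-0`) registered from its own folder (same three stub NAMES and SIGNATURES, so the
route's BC5 `plan-only` pointer `stub_rung_sha_corank_zero_234446a1` stays valid).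

## The crux (recall)

`ShaCorankZeroAtOnePrime` (X1 of the card kato-transfer-one-prime): for every elliptic `E/ℚ` on a global
minimal model `W` there is ONE prime `p ≥ 5` of good ORDINARY reduction (`p ∤ a_p`) at which the
`ℤ_p`-corank of `Ш(E/ℚ)[p^∞]` is `0` (`W.shaCorank p = 0`, `zpCorank` of the `p`-primary component of `W.sha`).

## The line: KATO TRANSFER AT ONE PRIME — buy `corank Ш[p^∞] = 0` from a NON-VANISHING p-adic
## coefficient, `[T^{r_MW}] L_p(E,T) ≠ 0` at one admissible prime, through Kato's Euler-system bound

Three registered stubs (the route header's foreseen two-layer split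
`OrderLeRankAtOnePrime + KatoSelmerCorankBound ⟹ ShaCorankZeroAtOnePrime` via the Kummer identity, plus the
BC5 plan-only rung):

* **S1 · `stub_orderLeRankAtOnePrime`** (the TRANSFER `C⁺`, load-bearing, research-sized): for every elliptic
  `W/ℚ` (globally minimal) there are an admissible prime `p` (`p ≥ 5`, good, `p ∤ a_p`) and a weight-2
  newform `f` of `W` (`IsNewformOf W f`; modularity, Wiles–BCDT) with
  `ord_{T=0} L_p(f, α_p, T) ≤ rank_ℤ E(ℚ)` in `ℕ∞` — i.e. the `T^{r_MW}`-coefficient (or an earlier one) of the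
  Mazur–Swinnerton-Dyer / Mazur–Tate–Teitelbaum `p`-adic `L`-function at the unit root `α_p = unitRoot W p`
  is NON-ZERO at ONE ordinary prime. WHY EASIER than the crux: it is a statement about ONE computable
  `p`-adic analytic object (certifiable instance-wise: `L_p ≠ 0` is the tree theorem
  `padicLFunction_ne_zero_holds` (Rohrlich), so `ord_T L_p < ⊤` always, and a non-vanishing coefficient has a
  finite certificate — Stein–Wuthrich 2013 §3, Alg. 3.5/Prop. 3.6), with the `p`-adic Gross–Zagier formula
  (Perrin-Riou 1987; `r = 1`: `ord_T L_p ≤ 1 ⟸ h_p(Heegner point) ≠ 0` at one `p`, Bertrand 1984 for CM)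
  and interpolation (`r_an = 0`, `α_p ≠ 1`: `L_p(0) = (1 − α_p⁻¹)² L(E,1)/Ω ≠ 0`) as the tools in ranks
  `≤ 1`; it is the `≤` half of the `p`-adic BSD RANK statement at one prime (Mazur–Tate–Teitelbaum 1986
  Conj. §II.10 (BSD(p)), rank part), strictly weaker than `p`-adic BSD at all `p`. OPEN for `r_MW ≥ 2` (no
  formula for `[T^k] L_p`, `k ≥ 2`) and for `r_MW = 0` with `Ш[p^∞]` a priori infinite (there it IS the rank-0
  converse) — exactly the crux's recorded risk, now on the analytic side.
* **S2 · `stub_katoSelmerCorankBound`** (KATO, Astérisque 295 (2004) Thm 18.4 corank form = Thm 17.4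
  divisibility `char_Λ X(E/ℚ_∞) ∣ L_p(E,T)` in `Λ ⊗ ℚ_p` + Mazur control; a THEOREM in print, open only as a
  formalisation): for every elliptic `W/ℚ` (globally minimal), every ODD good ordinary `p` and every
  weight-2 newform `f` of `W`, `corank_{ℤ_p} Sel_{p^∞}(E/ℚ) ≤ ord_{T=0} L_p(f, α_p, T)` in `ℕ∞`. VERBATIM the
  signature of the shared support item `LeadingTerm.KatoCorankBound` (stmt-BirchSwinnertonDyer-18048) and the
  ∀-closure of the Literature named fact `kato_selmerCorank_le_order_padicLFunction` (`KatoRankBound.lean`;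
  its `p`-free twin `…_allPrimes` has the reduction `kato_selmerCorank_le_order_padicLFunction_of_allPrimes`).
* **S3 · `stub_rung_sha_corank_zero_234446a1`** (BC5 PLAN-ONLY RUNG, not consumed by `_of`): the crux's
  instance at the smallest-conductor rank-4 curve 234446a1 = `[1,-1,0,-79,289]`
  (`Δ = 2²·117223`, so the model is globally minimal; `r_MW = 4`, `r_an ∈ {2, 4}` NOT certifiable — outside
  BSD-rank's individually-verified regime): `∃` admissible `p` with `corank Ш[p^∞] = 0`. Technique: S2 as a
  named fact + four independent points + a CERTIFIED non-vanishing `[T^4] L_p(E,T) ≠ 0` at one ordinary `p`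
  (Stein–Wuthrich 2013 Alg. 3.5, Prop. 3.6, §8–§9; `kit` PARI `ellpadicL`), then the Kummer identity.

`ShaCorankZeroAtOnePrime_of` is sorry-free logic over the tree: S1 gives `(p, f)` with
`ord_T L_p ≤ r_MW`; `p ≥ 5` is odd and `IsOrdinaryAt W p := ⟨good, p ∤ a_p⟩` (`isOrdinaryAt_iff`), so S2 at
`(p, f)` gives `s_p ≤ ord_T L_p`; hence `s_p ≤ r_MW` in `ℕ∞`, so in `ℕ`; the PROVED Kummer identity
`WeierstrassCurve.selmerCorank_eq_mordellWeilRank_add_holds` (`s_p = r_MW + corank Ш[p^∞]`, Greenberg LNM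
1716 §1) forces `corank Ш[p^∞] = 0` (`omega`).

Disproof.lean (`Cruxes/ShaCorankZeroAtOnePrime/Disproof.lean`, refuter-rattack cycle 1, 2026-08-17, verdict NO
KILL; it landed while this skeleton was being written and was read before registration): it contains NO
`_false_without_<H>` theorem, no tightness lemma, no refuted strengthening and no `-- Targets` stub kill, so there
is no obstruction for the stubs to honour; what it does record is USED here as follows — §4
`x1_iff_selmerCorank_eq_rank` / `not_x1_iff` (X1 ⟺ every curve has an admissible `p` with `s_p = r_MW`; a
counterexample is ONE curve with `r_MW < s_p` at EVERY admissible `p`) is exactly the form this line attacks: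
S1 + S2 produce `s_p ≤ r_MW` at one admissible `p`, the negation of the counterexample shape there; §2
`admissible_prime_exists` (tree theorem `exists_good_ordinary_prime_of_infinite infinite_goodOrdinaryPrimes_holds`)
is the non-vacuity of S1's prime set for every `E/ℚ`, CM included; §3 (X1 is dominated by
`TangentCone.SelmerRankShaPFinite`, stmt-0132, and by `ShaFiniteConjecture`) is the ALGEBRAIC ∀p line, deliberately
not this skeleton's (no stub assumes finiteness of any Ш). No landed Negative lemma exists
(`Theorems/ShaCorankZeroAtOnePrime/Negative/` absent). Negatives index of the summit (2026-08-17): one refuted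
statement, `LeadingTerm.TamePinch` (stmt-15532; CM curves have no admissible SURJECTIVE `p`) — no stub here carries
an image-of-Galois clause (S1 asks only good ordinary `p ≥ 5`; S2 has no image hypothesis; S3 is one non-CM curve).

BC3 probes (planner folder `bc/probe_crux.lean`, `bc/probe_summit.lean`, `bc/probe_S3_*_split.lean`,
`bc/probe_S3_crux_exactq.lean`, 2026-08-17; each stub statement copied VERBATIM as `def Sᵢ : Prop`, every probe its
own `example` under `maxHeartbeats 400000`; all files rc 1 with one error per `example`): for each stub `S`, both
`S → ShaCorankZeroAtOnePrime` and `S → BirchSwinnertonDyer` FAIL by (a) the BC2 battery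
`first | exact? | simpa [S] | (unfold S; simpa) | aesop`, (b) the literal battery `first | exact? | simpa | aesop`
and (c) both sides unfolded, binders introduced, `first | exact? | simp_all | aesop` — "unsolved goals" with
`aesop: failed to prove the goal after exhaustive search` (S1, S2: 6/6 each; S3 → summit: 3/3, and split
`exact?` = "could not close the goal"). The only non-verdicts are heartbeat TIMEOUTS (at `whnf`/`isDefEq`, still at
`maxHeartbeats 2000000`) of the FOLDED `exact?` on `S3 → crux` (first-order unification of the literal curve's
instance binders against the folded crux constant); split batteries for `S3 → crux` — `simpa using h` (cannot
synthesize `IsElliptic` of the literal curve), `simpa [S3]`, `unfold S3; simpa`, `aesop`, `unfold S3; aesop` — all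
FAIL outright, and with the crux unfolded and its binders introduced `exact?` FAILS outright ("could not close the
goal"), as do `simp_all` and `aesop`. No stub is cheaply the crux or the summit. Details: `Lines/birth.md`.
-/

set_option linter.unusedVariables false
set_option linter.dupNamespace false

noncomputable section

namespace Summit.BirchSwinnertonDyer.BirchSwinnertonDyer.Cruxes.ShaCorankZeroAtOnePrime.Birth

open scoped Classical
open Summit.BirchSwinnertonDyer.BirchSwinnertonDyer.Theses.KatoTransfer
open Literature Literature.NumberTheory.EllipticCurves Literature.NumberTheory.EllipticCurves.ModularForms

/-! ## Registered stubs -/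

/-- **S1 · `stub_orderLeRankAtOnePrime` — `p`-ADIC ORDER ≤ MORDELL–WEIL RANK AT ONE ADMISSIBLE PRIME**
(the transfer `C⁺`; load-bearing). For every elliptic `W/ℚ` on a global minimal model there are a prime
`p ≥ 5` of good ordinary reduction and a weight-2 newform `f` of `W` with
`ord_{T=0} L_p(f, unitRoot W p, T) ≤ rank_ℤ W(ℚ)` in `ℕ∞` (the coefficient `[T^{r_MW}] L_p ≠ 0` or an earlier
one). Rank-`≤ 1` tools: interpolation (`α_p ≠ 1`), `p`-adic Gross–Zagier (Perrin-Riou) + non-vanishing of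
ONE `p`-adic height (Bertrand for CM); `r_MW ≥ 2`: open (certifiable curve by curve, Stein–Wuthrich §3).
[cite: MazurTateTeitelbaum1986Invent, §II.10] [cite: PerrinRiou1987, Thm. 1.1] [cite: Bertrand1984ThetaCM]
[cite: SteinWuthrich2013, §3 and Prop. 3.6] [cite: RohrlichInventiones1984, Theorem p. 409] -/
theorem stub_orderLeRankAtOnePrime :
    ∀ (W : WeierstrassCurve ℚ) [W.IsElliptic] [W.IsGloballyMinimal], ∃ (p : ℕ) (_ : Fact p.Prime),
      5 ≤ p ∧ W.HasGoodReductionAtPrime p ∧ ¬ (p : ℤ) ∣ W.frobeniusTrace p ∧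
      ∃ (N : ℕ) (_ : NeZero N) (f : CuspForm (CongruenceSubgroup.Gamma0 N) 2),
        Literature.NumberTheory.EllipticCurves.ModularForms.IsNewformOf W f ∧
        (Literature.NumberTheory.EllipticCurves.padicLFunction f
            (Literature.NumberTheory.EllipticCurves.unitRoot W p : ℚ_[p])).order ≤
          (W.mordellWeilRank : ℕ∞) := by
  sorry

/-- **S2 · `stub_katoSelmerCorankBound` — KATO'S SELMER-CORANK BOUND** (Kato, Astérisque 295 (2004),
Thm 18.4 p. 281 / Thm 17.4 p. 273 + control; Greenberg LNM 1716 Thm 1.5, §4; Rubin, Euler Systems,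
Thms 2.3.2–2.3.4, `p ≠ 2`). For every elliptic `W/ℚ` (globally minimal), every odd good ordinary prime `p`
and every weight-2 newform `f` of `W`: `corank_{ℤ_p} Sel_{p^∞}(E/ℚ) ≤ ord_{T=0} L_p(f, unitRoot W p, T)` in
`ℕ∞`. Verbatim the shared support item `LeadingTerm.KatoCorankBound` (stmt-BirchSwinnertonDyer-18048) and
the ∀-closure over `(W, p, N, f)` of the named fact `kato_selmerCorank_le_order_padicLFunction`.
[cite: Kato2004Asterisque, Thm 18.4 (p. 281), Thm 17.4 (p. 273)] [cite: GreenbergLNM1716, Thm 1.5]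
[cite: Rubin2000, Thms 2.3.2–2.3.4] -/
theorem stub_katoSelmerCorankBound :
    ∀ (W : WeierstrassCurve ℚ) [W.IsElliptic] [W.IsGloballyMinimal] (p : ℕ) [Fact p.Prime], p ≠ 2 →
      Literature.NumberTheory.EllipticCurves.IsOrdinaryAt W p →
      ∀ {N : ℕ} [NeZero N] (f : CuspForm (CongruenceSubgroup.Gamma0 N) 2),
        Literature.NumberTheory.EllipticCurves.ModularForms.IsNewformOf W f →
        (WeierstrassCurve.selmerCorank W p : ℕ∞) ≤
          (Literature.NumberTheory.EllipticCurves.padicLFunction f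
            (Literature.NumberTheory.EllipticCurves.unitRoot W p : ℚ_[p])).order := by
  sorry

/-- **S3 · `stub_rung_sha_corank_zero_234446a1` — BC5 PLAN-ONLY RUNG** (the crux at the smallest-conductor
rank-4 curve 234446a1 = `[1, -1, 0, -79, 289]`, `Δ = 2²·117223`, `r_MW = 4`, `r_an ∈ {2,4}` not certifiable,
so OUTSIDE BSD-rank's verified regime): some admissible `p` has `corank_{ℤ_p} Ш(E/ℚ)[p^∞] = 0`. Plan: S2 as a
named fact, four independent rational points, and a certified `[T^4] L_p(E,T) ≠ 0` at one good ordinary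
`p ≥ 5` (Stein–Wuthrich 2013 Alg. 3.5 / Prop. 3.6 / §9; PARI `ellpadicL`), then the Kummer identity. Not a
hypothesis of `ShaCorankZeroAtOnePrime_of` (an instance of the crux cannot feed its proof).
[cite: SteinWuthrich2013, Thm 1.1, Prop. 3.6, §9] [cite: Kato2004Asterisque, Thm 18.4] -/
theorem stub_rung_sha_corank_zero_234446a1 :
    ∀ [(⟨1, -1, 0, -79, 289⟩ : WeierstrassCurve ℚ).IsElliptic]
      [(⟨1, -1, 0, -79, 289⟩ : WeierstrassCurve ℚ).IsGloballyMinimal],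
      ∃ (p : ℕ) (_ : Fact p.Prime), 5 ≤ p ∧
        (⟨1, -1, 0, -79, 289⟩ : WeierstrassCurve ℚ).HasGoodReductionAtPrime p ∧
        ¬ (p : ℤ) ∣ (⟨1, -1, 0, -79, 289⟩ : WeierstrassCurve ℚ).frobeniusTrace p ∧
        (⟨1, -1, 0, -79, 289⟩ : WeierstrassCurve ℚ).shaCorank p = 0 := by
  sorry

/-! ## Stub statements by name -/

namespace Statement

/-- Statement of `stub_orderLeRankAtOnePrime`. -/
abbrev stub_orderLeRankAtOnePrime : Prop := type_of% @Birth.stub_orderLeRankAtOnePrime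
/-- Statement of `stub_katoSelmerCorankBound`. -/
abbrev stub_katoSelmerCorankBound : Prop := type_of% @Birth.stub_katoSelmerCorankBound
/-- Statement of `stub_rung_sha_corank_zero_234446a1` (BC5 rung; recorded, not consumed). -/
abbrev stub_rung_sha_corank_zero_234446a1 : Prop := type_of% @Birth.stub_rung_sha_corank_zero_234446a1

end Statement

/-! ## The composition (sorry-free) -/

/-- **`ShaCorankZeroAtOnePrime_of`** — the two load-bearing stub STATEMENTS imply the crux, BY NAME. Logic
over proved tree results only: S1 gives an admissible `(p, f)` with `ord_T L_p ≤ r_MW`; `p ≥ 5` is odd and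
`IsOrdinaryAt W p = ⟨good, p ∤ a_p⟩`, so S2 gives `s_p ≤ ord_T L_p`; thus `s_p ≤ r_MW` (cast down from `ℕ∞`),
and the proved Kummer identity `selmerCorank_eq_mordellWeilRank_add_holds` (`s_p = r_MW + corank Ш[p^∞]`)
forces `corank Ш[p^∞] = 0`. -/
theorem ShaCorankZeroAtOnePrime_of (h1 : Statement.stub_orderLeRankAtOnePrime)
    (h2 : Statement.stub_katoSelmerCorankBound) : ShaCorankZeroAtOnePrime := by
  intro W iE iM
  obtain ⟨p, hp, h5, hgood, hord, N, hN, f, hf, hle⟩ := h1 W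
  refine ⟨p, hp, h5, hgood, hord, ?_⟩
  have hp2 : p ≠ 2 := by omega
  have hordAt : Literature.NumberTheory.EllipticCurves.IsOrdinaryAt W p := ⟨hgood, hord⟩
  have hk := h2 W p hp2 hordAt f hf
  have hsr : W.selmerCorank p ≤ W.mordellWeilRank := by exact_mod_cast hk.trans hle
  have hid : W.selmerCorank p = W.mordellWeilRank + W.shaCorank p :=
    WeierstrassCurve.selmerCorank_eq_mordellWeilRank_add_holds W p
  omega

/-- The crux along this line, MODULO the two load-bearing registered stubs (sorries live only in `stub_*`). -/
theorem ShaCorankZeroAtOnePrime_proof : ShaCorankZeroAtOnePrime :=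
  ShaCorankZeroAtOnePrime_of stub_orderLeRankAtOnePrime stub_katoSelmerCorankBound

end Summit.BirchSwinnertonDyer.BirchSwinnertonDyer.Cruxes.ShaCorankZeroAtOnePrime.Birth

end
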